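import Summits.Ventures.PercRepro.ThetaSigma

/-!
# The separated (Σ)-count: meets and co-joins counted apart, and the split at a point

Dossier proofs/MINE1-theoremS.md, Addendum 77 (mine-1, gen 40). Split the (Σ)-difference family
`sigmaD U X = {∅} ∪ M ∪ C` of `ThetaSigma.lean` into its two halves, the **meet family**
`sigmaMeets X = {∅} ∪ {x ⊓ y : x ≠ y ∈ X}` and the **co-join family**
`sigmaCojoins U X = {U \ (x ⊔ y) : x ≠ y ∈ X}`, and count them SEPARATELY:
`sepCount U X = |sigmaMeets X| + |sigmaCojoins U X| ≥ |sigmaD U X|`. This file holds the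
definitions and the two tools of the ground-set induction of `ThetaSigmaSepMain.lean`:

* `card_eq_card_image_erase_add_card_qEdges` — **the split of any family `G` of sets at a point
  `q`**: `|G| = |π_q G| + |q-edges of G|`, where `π_q G = {d \ q : d ∈ G}` and a `q`-edge is a
  `q`-free `d ∈ G` with `d + q ∈ G` (`qEdges`);
* `sigmaMeets_image_erase_subset`, `sigmaCojoins_image_erase_subset` — **lifting**: the halves of
  the projected family `π_q X` lie inside the projected halves of `X`; hence
  `sepCount_image_erase_add_le`: `sepCount (U \ q) (π_q X) + (q-edges of both halves) ≤ sepCount U X`.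
-/

namespace PercRepro.MSTight

open Finset

variable {α : Type*} [DecidableEq α]

section Defs

/-- The **meet family** of `X`: `∅` together with the meets of two distinct members. -/
def sigmaMeets (X : Finset (Finset α)) : Finset (Finset α) :=
  insert ∅ (X.offDiag.image fun p => p.1 ⊓ p.2)

/-- The **co-join family** of `X` relative to `U`: the relative co-joins `U \ (x ⊔ y)` of two
distinct members. -/
def sigmaCojoins (U : Finset α) (X : Finset (Finset α)) : Finset (Finset α) :=
  X.offDiag.image fun p => U \ (p.1 ⊔ p.2)

/-- The **separated count**: meets and co-joins counted separately. -/
def sepCount (U : Finset α) (X : Finset (Finset α)) : ℕ :=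
  (sigmaMeets X).card + (sigmaCojoins U X).card

variable {U : Finset α} {X : Finset (Finset α)}

/-- Membership in the meet family. -/
theorem mem_sigmaMeets {E : Finset α} :
    E ∈ sigmaMeets X ↔ E = ∅ ∨ ∃ x ∈ X, ∃ y ∈ X, x ≠ y ∧ x ⊓ y = E := by
  unfold sigmaMeets
  simp only [mem_insert, mem_image, mem_offDiag, Prod.exists]
  constructor
  · rintro (h | ⟨x, y, ⟨hx, hy, hxy⟩, h⟩)
    · exact Or.inl h
    · exact Or.inr ⟨x, hx, y, hy, hxy, h⟩
  · rintro (h | ⟨x, hx, y, hy, hxy, h⟩)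
    · exact Or.inl h
    · exact Or.inr ⟨x, y, ⟨hx, hy, hxy⟩, h⟩

/-- Membership in the co-join family. -/
theorem mem_sigmaCojoins {E : Finset α} :
    E ∈ sigmaCojoins U X ↔ ∃ x ∈ X, ∃ y ∈ X, x ≠ y ∧ U \ (x ⊔ y) = E := by
  unfold sigmaCojoins
  simp only [mem_image, mem_offDiag, Prod.exists]
  constructor
  · rintro ⟨x, y, ⟨hx, hy, hxy⟩, h⟩
    exact ⟨x, hx, y, hy, hxy, h⟩
  · rintro ⟨x, hx, y, hy, hxy, h⟩
    exact ⟨x, y, ⟨hx, hy, hxy⟩, h⟩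

/-- `∅` is in the meet family. -/
theorem empty_mem_sigmaMeets (X : Finset (Finset α)) : ∅ ∈ sigmaMeets X :=
  mem_sigmaMeets.2 (Or.inl rfl)

/-- The meet of two distinct members is in the meet family. -/
theorem inf_mem_sigmaMeets {x y : Finset α} (hxy : x ≠ y) (hx : x ∈ X) (hy : y ∈ X) :
    x ⊓ y ∈ sigmaMeets X :=
  mem_sigmaMeets.2 (Or.inr ⟨x, hx, y, hy, hxy, rfl⟩)

/-- The relative co-join of two distinct members is in the co-join family. -/
theorem sdiff_sup_mem_sigmaCojoins {x y : Finset α} (hxy : x ≠ y) (hx : x ∈ X) (hy : y ∈ X) :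
    U \ (x ⊔ y) ∈ sigmaCojoins U X :=
  mem_sigmaCojoins.2 ⟨x, hx, y, hy, hxy, rfl⟩

/-- The (Σ)-difference family is the union of its two halves. -/
theorem sigmaD_eq_sigmaMeets_union_sigmaCojoins (U : Finset α) (X : Finset (Finset α)) :
    sigmaD U X = sigmaMeets X ∪ sigmaCojoins U X := by
  ext E
  rw [mem_sigmaD, mem_union, mem_sigmaMeets, mem_sigmaCojoins, or_assoc]

/-- The union bound: `|sigmaD U X| ≤ sepCount U X`. -/
theorem card_sigmaD_le_sepCount (U : Finset α) (X : Finset (Finset α)) :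
    (sigmaD U X).card ≤ sepCount U X := by
  rw [sigmaD_eq_sigmaMeets_union_sigmaCojoins]
  exact card_union_le _ _

/-- The meet family has at least one element. -/
theorem one_le_card_sigmaMeets (X : Finset (Finset α)) : 1 ≤ (sigmaMeets X).card :=
  card_pos.2 ⟨∅, empty_mem_sigmaMeets X⟩

end Defs

section Edges

variable {q : α}

/-- The **`q`-edges** of a family `G` of sets: the `q`-free sets `d ∈ G` with `d + q ∈ G`
(recorded by their `q`-free end). -/
def qEdges (q : α) (G : Finset (Finset α)) : Finset (Finset α) :=
  (G.filter fun d => q ∉ d) ∩ ((G.filter fun d => q ∈ d).image fun d => d.erase q)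

/-- Membership in the `q`-edges. -/
theorem mem_qEdges {G : Finset (Finset α)} {d : Finset α} :
    d ∈ qEdges q G ↔ d ∈ G ∧ q ∉ d ∧ insert q d ∈ G := by
  unfold qEdges
  simp only [mem_inter, mem_filter, mem_image]
  constructor
  · rintro ⟨⟨hd, hq⟩, e, ⟨he, hqe⟩, rfl⟩
    refine ⟨hd, hq, ?_⟩
    rwa [insert_erase hqe]
  · rintro ⟨hd, hq, hi⟩
    exact ⟨⟨hd, hq⟩, insert q d, ⟨hi, mem_insert_self q d⟩, erase_insert hq⟩

/-- **The split of a family at a point**: `|G| = |π_q G| + |q-edges of G|`, where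
`π_q G = {d \ q : d ∈ G}`. -/
theorem card_eq_card_image_erase_add_card_qEdges (q : α) (G : Finset (Finset α)) :
    G.card = (G.image fun d => d.erase q).card + (qEdges q G).card := by
  set G₀ := G.filter fun d => q ∉ d with hG₀
  set G₁ := G.filter fun d => q ∈ d with hG₁
  have hsplit : G₁.card + G₀.card = G.card := card_filter_add_card_filter_not _
  have himg : G.image (fun d => d.erase q) = G₀ ∪ G₁.image (fun d => d.erase q) := by
    ext d
    simp only [mem_image, mem_union, hG₀, hG₁, mem_filter]
    constructor
    · rintro ⟨e, he, rfl⟩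
      by_cases hq : q ∈ e
      · exact Or.inr ⟨e, ⟨he, hq⟩, rfl⟩
      · exact Or.inl ⟨by rwa [erase_eq_of_notMem hq], by simp⟩
    · rintro (⟨hd, hq⟩ | ⟨e, ⟨he, hq⟩, rfl⟩)
      · exact ⟨d, hd, erase_eq_of_notMem hq⟩
      · exact ⟨e, he, rfl⟩
  have hinj : Set.InjOn (fun d : Finset α => d.erase q) G₁ := by
    intro x hx y hy hxy
    simp only [hG₁, coe_filter, Set.mem_setOf_eq] at hx hy
    have := congrArg (insert q) hxy
    simp only at this
    rwa [insert_erase hx.2, insert_erase hy.2] at this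
  have hcard1 : (G₁.image fun d => d.erase q).card = G₁.card := card_image_of_injOn hinj
  have hedges : qEdges q G = G₀ ∩ G₁.image (fun d => d.erase q) := rfl
  rw [himg, hedges, card_union_add_card_inter, hcard1, add_comm, hsplit]

end Edges

section Projection

variable {q : α} {U : Finset α} {X : Finset (Finset α)}

/-- Erasing a point distributes over the meet. -/
theorem inf_erase (x y : Finset α) (q : α) : (x ⊓ y).erase q = x.erase q ⊓ y.erase q := by
  ext a
  simp only [mem_erase, inf_eq_inter, mem_inter]
  tauto

/-- Erasing a point distributes over the relative co-join. -/
theorem sdiff_sup_erase (U x y : Finset α) (q : α) :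
    (U \ (x ⊔ y)).erase q = U.erase q \ (x.erase q ⊔ y.erase q) := by
  ext a
  simp only [mem_erase, mem_sdiff, sup_eq_union, mem_union]
  tauto

/-- **Lifting the meets**: the meet family of the projection lies inside the projected meet
family. -/
theorem sigmaMeets_image_erase_subset (q : α) (X : Finset (Finset α)) :
    sigmaMeets (X.image fun x => x.erase q) ⊆ (sigmaMeets X).image fun d => d.erase q := by
  intro E hE
  rw [mem_sigmaMeets] at hE
  rw [mem_image]
  rcases hE with rfl | ⟨x', hx', y', hy', hne, rfl⟩
  · exact ⟨∅, empty_mem_sigmaMeets X, erase_empty q⟩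
  · obtain ⟨x, hx, rfl⟩ := mem_image.1 hx'
    obtain ⟨y, hy, rfl⟩ := mem_image.1 hy'
    have hxy : x ≠ y := fun h => hne (h ▸ rfl)
    exact ⟨x ⊓ y, inf_mem_sigmaMeets hxy hx hy, inf_erase x y q⟩

/-- **Lifting the co-joins**: the co-join family of the projection (relative to `U \ q`) lies
inside the projected co-join family. -/
theorem sigmaCojoins_image_erase_subset (q : α) (U : Finset α) (X : Finset (Finset α)) :
    sigmaCojoins (U.erase q) (X.image fun x => x.erase q) ⊆
      (sigmaCojoins U X).image fun d => d.erase q := by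
  intro E hE
  rw [mem_sigmaCojoins] at hE
  obtain ⟨x', hx', y', hy', hne, rfl⟩ := hE
  obtain ⟨x, hx, rfl⟩ := mem_image.1 hx'
  obtain ⟨y, hy, rfl⟩ := mem_image.1 hy'
  have hxy : x ≠ y := fun h => hne (h ▸ rfl)
  exact mem_image.2 ⟨U \ (x ⊔ y), sdiff_sup_mem_sigmaCojoins hxy hx hy, sdiff_sup_erase U x y q⟩

/-- **The lifting inequality**: the separated count of `X` is at least the separated count of
the projection plus the `q`-edges of both halves. -/
theorem sepCount_image_erase_add_le (q : α) (U : Finset α) (X : Finset (Finset α)) :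
    sepCount (U.erase q) (X.image fun x => x.erase q) +
      ((qEdges q (sigmaMeets X)).card + (qEdges q (sigmaCojoins U X)).card) ≤ sepCount U X := by
  unfold sepCount
  have h1 := card_eq_card_image_erase_add_card_qEdges q (sigmaMeets X)
  have h2 := card_eq_card_image_erase_add_card_qEdges q (sigmaCojoins U X)
  have h3 := card_le_card (sigmaMeets_image_erase_subset q X)
  have h4 := card_le_card (sigmaCojoins_image_erase_subset q U X)
  omega

end Projection

end PercRepro.MSTight
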